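import Literature.AnabelianGeometry.EtaleTheta.Discharge.Sec2Cor218ivTrivialBaseDY
import HarnessLib

/-!
# [EtTh] Cor. 2.18 (iv), surjectivity, for `ThetaEnvData` with `G_K = 1` and NON-trivial `D_Y`: the
# `D_Y`-aware lifting criterion (proof-only)

S. Mochizuki, *The Étale Theta Function …* [EtTh], Publ. RIMS **45** (2009), §2, Def. 2.13 (i)–(ii) p. 47,
Cor. 2.18 (iv) pp. 61–63 (locators `p.N` = PDF pages; bib key `MochizukiEtTh2009`).

PROOF-ONLY sequel (no `def`, no instance, no new named fact) of `Sec2Cor218ivTrivialBaseSharp.lean` /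
`Sec2Cor218ivTrivialBaseDY.lean` (same seat).  The lifting criteria landed so far
(`exists_iso_over_of_coeff`, `exists_iso_over_of_coeff_hom`) assume `D_Y = 1`.  With `G_K = 1` but
`D_Y ≠ 1` (a genuine `Gal(Y/X)`-action, as at the discrete Heisenberg skeleton of `(Π^tp_X)^Θ`), the lift
`A₀ : (u, y) ↦ (ψ u · f(y), γ y)` of an automorphism `γ` of `Π^tp_X` must in addition NORMALISE `D_Y`:

* `conjX_comp_of_shape_hom` — if the homomorphism part `f` is `Π^tp_X`-conjugation invariant (the
  necessary condition of `iso_left_algSection_conj`), then `A₀ ∘ conj_x = conj_{γ x} ∘ A₀`, hence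
  `A₀ conj_x A₀⁻¹ = conj_{γ x}`: `A₀` permutes the `Gal(Y/X)`-generators of `D_Y` (the Kummer generators
  are trivial), so `[A₀]` normalises `D_Y` (`DY_map_conj_eq_of_shape_hom`, via abc-iut-L2-t10's
  `DY_map_conj_eq_of_generators`);
* `exists_iso_over_of_coeff_hom_conj` — **the `D_Y`-aware lifting criterion**: `γ` preserving `Π^tp_Y`,
  `Π^tp_Ÿ`, a coefficient automorphism `ψ` and a continuous, conjugation-invariant `f` with
  `ψ (η y) = f(y) · η(γ y)` on `Π^tp_Ÿ` give a model automorphism of `M(η)` over `γ|_{Π^tp_Y}` — with NO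
  hypothesis on `D_Y`.

HONEST FRAMING: statements about the cell's own typing over an abstract interface; nothing here bears on
[EtTh] (refereed) or on [IUTchIII] Cor. 3.12; no side taken; typed ≠ proved.  Cell `abc-iut`, seat
abc-iut-f-151 (tranche 151).
-/

namespace Literature.AnabelianGeometry.EtaleTheta

universe u

namespace ThetaEnvData

variable {N : ℕ+} (T : ThetaEnvData.{u} N)

section SubsingletonG

variable [Subsingleton T.G]

/-- With `G_K = 1`: an automorphism `c` of the envelope of SHAPE `(u, y) ↦ (ψ u · f(y), γ y)` with `f`
conjugation invariant INTERTWINES the `Gal(Y/X)`-conjugations: `c ∘ conj_x = conj_{γ x} ∘ c`.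
[cite: MochizukiEtTh2009, Cor 2.18(iv) p.61] -/
theorem conjX_comp_of_shape_hom (c : MulAut T.env) (γ : T.PiX ≃ₜ* T.PiX) (ψ : T.mu ≃* T.mu)
    (f : T.PiY →* T.mu)
    (hl : ∀ z : T.env, (c z).left = ψ z.left * f z.right)
    (hr : ∀ z : T.env, (((c z).right : T.PiY) : T.PiX) = γ (z.right : T.PiX))
    (hfinv : ∀ (g : T.PiX) (y : T.PiY), f ⟨g * (y : T.PiX) * g⁻¹, T.PiY_normal.conj_mem _ y.2 g⟩ = f y)
    (x : T.PiX) : c * T.conjX x = T.conjX (γ x) * c := by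
  refine MulEquiv.ext fun z => ?_
  rw [MulAut.mul_apply, MulAut.mul_apply]
  refine SemidirectProduct.ext ?_ ?_
  · rw [hl]
    change ψ (T.chi (T.aug x) z.left) * f ⟨x * (z.right : T.PiX) * x⁻¹, _⟩ =
      T.chi (T.aug (γ x)) (c z).left
    rw [Subsingleton.elim (T.aug x) 1, Subsingleton.elim (T.aug (γ x)) 1, map_one, MulAut.one_apply,
      MulAut.one_apply, hfinv, hl]
  · apply Subtype.ext
    change (((c (T.conjX x z)).right : T.PiY) : T.PiX) = γ x * (((c z).right : T.PiY) : T.PiX) * (γ x)⁻¹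
    rw [hr, hr]
    change γ (x * (z.right : T.PiX) * x⁻¹) = _
    rw [map_mul, map_mul, map_inv]

/-- **`[c]` normalises `D_Y`** for `c` of shape `(u, y) ↦ (ψ u · f(y), γ y)` with `f` conjugation
invariant (`G_K = 1`): `c conj_x c⁻¹ = conj_{γ x}` and `c⁻¹ conj_{x} c = conj_{γ⁻¹ x}`, while the Kummer
generators of `D_Y` are trivial. [cite: MochizukiEtTh2009, Cor 2.18(iv) p.61] -/
theorem DY_map_conj_eq_of_shape_hom (c : contMulAut T.env) (γ : T.PiX ≃ₜ* T.PiX) (ψ : T.mu ≃* T.mu)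
    (f : T.PiY →* T.mu)
    (hl : ∀ z : T.env, ((c : MulAut T.env) z).left = ψ z.left * f z.right)
    (hr : ∀ z : T.env, ((((c : MulAut T.env) z).right : T.PiY) : T.PiX) = γ (z.right : T.PiX))
    (hfinv : ∀ (g : T.PiX) (y : T.PiY), f ⟨g * (y : T.PiX) * g⁻¹, T.PiY_normal.conj_mem _ y.2 g⟩ = f y) :
    T.DY.map (MulAut.conj (TopOut.mk _ c)).toMonoidHom = T.DY := by
  -- the `Gal(Y/X)`-generators are permuted: `[c][conj_x][c]⁻¹ = [conj_{γ x}]`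
  have hgal : ∀ x : T.PiX, TopOut.mk _ c * TopOut.mk _ ⟨T.conjX x, T.conjX_mem_contMulAut x⟩ *
      (TopOut.mk _ c)⁻¹ = TopOut.mk _ ⟨T.conjX (γ x), T.conjX_mem_contMulAut (γ x)⟩ := by
    intro x
    rw [← map_mul, ← map_inv, ← map_mul]
    congr 1
    apply Subtype.ext
    change (c : MulAut T.env) * T.conjX x * ((c⁻¹ : contMulAut T.env) : MulAut T.env) = T.conjX (γ x)
    rw [T.conjX_comp_of_shape_hom (c : MulAut T.env) γ ψ f hl hr hfinv x, mul_assoc]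
    change T.conjX (γ x) * ((c * c⁻¹ : contMulAut T.env) : MulAut T.env) = _
    rw [mul_inv_cancel]
    exact mul_one _
  -- the Kummer generators are trivial
  have hkum : ∀ (δ : T.G → T.mu) (hδ : CycEnvelope.IsEnvCocycle T.augY T.chi (δ ∘ T.augY))
      (hc : CycEnvelope.shift hδ ∈ contMulAut T.env), TopOut.mk _ ⟨CycEnvelope.shift hδ, hc⟩ = 1 := by
    intro δ hδ hc
    have h1 : (⟨CycEnvelope.shift hδ, hc⟩ : contMulAut T.env) = 1 :=
      Subtype.ext (T.shift_inflated_eq_one hδ)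
    rw [h1, map_one]
  refine T.DY_map_conj_eq_of_generators c ?_ ?_
  · rintro d (⟨δ, hδ, hc, rfl⟩ | ⟨x, hcx, rfl⟩)
    · rw [hkum, mul_one, mul_inv_cancel]
      exact T.DY.one_mem
    · have hx : (⟨T.conjX x, hcx⟩ : contMulAut T.env) = ⟨T.conjX x, T.conjX_mem_contMulAut x⟩ := rfl
      rw [hx, hgal]
      exact T.mk_conjX_mem_DY (γ x)
  · rintro d (⟨δ, hδ, hc, rfl⟩ | ⟨x, hcx, rfl⟩)
    · rw [hkum, mul_one, inv_mul_cancel]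
      exact T.DY.one_mem
    · have hx : (⟨T.conjX x, hcx⟩ : contMulAut T.env) =
          ⟨T.conjX (γ (γ.symm x)), T.conjX_mem_contMulAut (γ (γ.symm x))⟩ :=
        Subtype.ext (by change T.conjX x = T.conjX (γ (γ.symm x)); rw [γ.apply_symm_apply])
      rw [hx, ← hgal (γ.symm x), ← mul_assoc, ← mul_assoc, inv_mul_cancel, one_mul, mul_assoc,
        inv_mul_cancel, mul_one]
      exact T.mk_conjX_mem_DY (γ.symm x)

/-- **Cor. 2.18 (iv), surjectivity — the `D_Y`-AWARE lifting criterion** (`G_K = 1`, no hypothesis on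
`D_Y`): an automorphism `γ` of `Π^tp_X` preserving `Π^tp_Y` and `Π^tp_Ÿ`, a coefficient automorphism
`ψ`, and a continuous homomorphism `f : Π^tp_Y → μ_N`, INVARIANT under `Π^tp_X`-conjugation, with
`ψ (η y) = f(y) · η(γ y)` on `Π^tp_Ÿ`, give the model automorphism `(u, y) ↦ (ψ u · f(y), γ y)` of
`M(η)` over `γ|_{Π^tp_Y}` (it normalises `D_Y` by `DY_map_conj_eq_of_shape_hom`).
[cite: MochizukiEtTh2009, Cor 2.18(iv) p.61] -/
theorem exists_iso_over_of_coeff_hom_conj {η : T.PiYdd → T.mu} (hη : η ∈ T.thetaCocycles)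
    (γ : T.PiX ≃ₜ* T.PiX) (hY : ∀ g : T.PiX, g ∈ T.PiY → γ g ∈ T.PiY)
    (hY' : ∀ g : T.PiX, g ∈ T.PiY → γ.symm g ∈ T.PiY)
    (hdd : ∀ g : T.PiX, g ∈ T.PiYdd → γ g ∈ T.PiYdd)
    (hdd' : ∀ g : T.PiX, g ∈ T.PiYdd → γ.symm g ∈ T.PiYdd)
    (ψ : T.mu ≃* T.mu) (f : T.PiY →* T.mu) (hf : Continuous f)
    (hfinv : ∀ (g : T.PiX) (y : T.PiY), f ⟨g * (y : T.PiX) * g⁻¹, T.PiY_normal.conj_mem _ y.2 g⟩ = f y)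
    (hψ : ∀ y : T.PiYdd, ψ (η y) = f (T.inclYdd y) * η ⟨γ y, hdd y y.2⟩) :
    ∃ α : (T.modelMono hη).Iso (T.modelMono hη),
      ∀ x : T.env, ((CycEnvelope.proj T.augY T.chi (α.e x) : T.PiY) : T.PiX) =
        γ ((CycEnvelope.proj T.augY T.chi x : T.PiY) : T.PiX) := by
  -- the restriction of `γ`, `γ⁻¹` to `Π^tp_Y`
  let gY : T.PiY → T.PiY := fun y => ⟨γ (y : T.PiX), hY _ y.2⟩
  let gY' : T.PiY → T.PiY := fun y => ⟨γ.symm (y : T.PiX), hY' _ y.2⟩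
  have hgg' : ∀ y, gY (gY' y) = y := fun y => Subtype.ext (γ.apply_symm_apply (y : T.PiX))
  have hg'g : ∀ y, gY' (gY y) = y := fun y => Subtype.ext (γ.symm_apply_apply (y : T.PiX))
  have hgmul : ∀ y y' : T.PiY, gY (y * y') = gY y * gY y' := fun y y' =>
    Subtype.ext (by change γ ((y : T.PiX) * y') = γ y * γ y'; rw [map_mul])
  -- the automorphism `A₀ : (a, y) ↦ (ψ a · f y, γ y)`
  let A₀ : MulAut T.env :=
    { toFun := fun x => ⟨ψ x.left * f x.right, gY x.right⟩
      invFun := fun x => ⟨ψ.symm (x.left * (f (gY' x.right))⁻¹), gY' x.right⟩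
      left_inv := fun x => by
        refine SemidirectProduct.ext ?_ ?_
        · change ψ.symm (ψ x.left * f x.right * (f (gY' (gY x.right)))⁻¹) = x.left
          rw [hg'g, mul_inv_cancel_right, MulEquiv.symm_apply_apply]
        · exact hg'g x.right
      right_inv := fun x => by
        refine SemidirectProduct.ext ?_ ?_
        · change ψ (ψ.symm (x.left * (f (gY' x.right))⁻¹)) * f (gY' x.right) = x.left
          rw [MulEquiv.apply_symm_apply, inv_mul_cancel_right]
        · exact hgg' x.right
      map_mul' := fun x y => by
        refine SemidirectProduct.ext ?_ ?_
        · change ψ (x * y).left * f (x * y).right = _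
          rw [mul_left_eq, mul_left_eq, map_mul, SemidirectProduct.mul_right, map_mul]
          exact mul_mul_mul_comm _ _ _ _
        · change gY (x * y).right = gY x.right * gY y.right
          rw [SemidirectProduct.mul_right, hgmul] }
  -- continuity of `A₀`
  have hlc : Continuous fun x : T.env => x.left :=
    (continuous_fst.comp continuous_induced_dom :
      Continuous (Prod.fst ∘ fun x : T.env => (x.left, x.right)))
  have hrc₀ : Continuous fun x : T.env => x.right :=
    (continuous_snd.comp continuous_induced_dom :
      Continuous (Prod.snd ∘ fun x : T.env => (x.left, x.right)))
  have hrc : Continuous fun x : T.env => ((x.right : T.PiY) : T.PiX) :=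
    continuous_subtype_val.comp hrc₀
  have hgYc : Continuous gY := (γ.continuous.comp continuous_subtype_val).subtype_mk _
  have hgY'c : Continuous gY' := (γ.symm.continuous.comp continuous_subtype_val).subtype_mk _
  have hA₀c : A₀ ∈ contMulAut T.env := by
    refine ⟨?_, ?_⟩
    · refine continuous_induced_rng.2 ?_
      change Continuous fun x : T.env => ((ψ x.left * f x.right, gY x.right) : T.mu × T.PiY)
      exact (((continuous_of_discreteTopology (f := fun a : T.mu => ψ a)).comp hlc).mul
        (hf.comp hrc₀)).prodMk (hgYc.comp hrc₀)
    · refine continuous_induced_rng.2 ?_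
      change Continuous fun x : T.env =>
        ((ψ.symm (x.left * (f (gY' x.right))⁻¹), gY' x.right) : T.mu × T.PiY)
      exact ((continuous_of_discreteTopology (f := fun a : T.mu => ψ.symm a)).comp
        (hlc.mul ((hf.comp (hgY'c.comp hrc₀)).inv))).prodMk (hgY'c.comp hrc₀)
  set cA : contMulAut T.env := ⟨A₀, hA₀c⟩ with hcA
  -- `A₀` carries `s^Θ(y)` to `s^Θ(γ y)`
  have hAs : ∀ y : T.PiYdd, A₀ (T.sTheta hη y) = T.sTheta hη ⟨γ y, hdd y y.2⟩ := by
    intro y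
    refine SemidirectProduct.ext ?_ (Subtype.ext rfl)
    change ψ (η y)⁻¹ * f (T.inclYdd y) = (η ⟨γ y, hdd y y.2⟩)⁻¹
    rw [map_inv, hψ, mul_inv_rev, inv_mul_cancel_right]
  have hs : (T.sTheta hη).range.map (cA : MulAut T.env).toMonoidHom = (T.sTheta hη).range := by
    ext x
    constructor
    · rintro ⟨_, ⟨y, rfl⟩, rfl⟩
      exact ⟨⟨γ y, hdd y y.2⟩, (hAs y).symm⟩
    · rintro ⟨y, rfl⟩
      refine ⟨_, ⟨⟨γ.symm y, hdd' y y.2⟩, rfl⟩, ?_⟩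
      change A₀ _ = _
      rw [hAs]
      exact congrArg _ (Subtype.ext (γ.apply_symm_apply (y : T.PiX)))
  have hDmap : T.DY.map (MulAut.conj (TopOut.mk _ cA)).toMonoidHom = T.DY :=
    T.DY_map_conj_eq_of_shape_hom cA γ ψ f (fun z => rfl) (fun z => rfl) hfinv
  have hμ : ∀ a, (cA : MulAut T.env) (CycEnvelope.inMu T.augY T.chi a) =
      CycEnvelope.inMu T.augY T.chi (ψ a) := fun a => by
    refine SemidirectProduct.ext ?_ ?_
    · change ψ (CycEnvelope.inMu T.augY T.chi a).left * f (CycEnvelope.inMu T.augY T.chi a).right = _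
      rw [SemidirectProduct.left_inl, SemidirectProduct.right_inl, map_one, mul_one]
      rfl
    · change gY (CycEnvelope.inMu T.augY T.chi a).right = (CycEnvelope.inMu T.augY T.chi (ψ a)).right
      apply Subtype.ext
      change γ (((CycEnvelope.inMu T.augY T.chi a).right : T.PiY) : T.PiX) =
        (((CycEnvelope.inMu T.augY T.chi (ψ a)).right : T.PiY) : T.PiX)
      simp
  obtain ⟨α, hα⟩ := T.exists_modelIso_of_aut' hη hη cA hDmap
    (fun a => ⟨ψ a, hμ a⟩) (fun b => ⟨ψ.symm b, by rw [hμ, MulEquiv.apply_symm_apply]⟩) hs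
  exact ⟨α, fun x => by rw [hα]; rfl⟩

end SubsingletonG

end ThetaEnvData

end Literature.AnabelianGeometry.EtaleTheta
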